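import Literature.AlgebraicGeometry.ShimuraVarieties.UnitaryBallAutomorphicFubiniStudyExact
import HarnessLib

/-!
# The weight law of the Fubini–Study classes of projective systems of automorphic forms on a ball quotient

Layer `Literature/AlgebraicGeometry/ShimuraVarieties`, grouping namespace `BallFS`; sequel of
`UnitaryBallAutomorphicFubiniStudyExact` (two projective systems of automorphic forms of the SAME weight on a free
quotient `Δ\𝔹²` have cohomologous Fubini–Study forms, `BallFS.deRhamCohomology_mk_fsForm_eq`).  ONE NAMED FACT
(net Literature debt **+1**; cell hodgecm-mathlib row B3-25, director g2 ruling (β)+(γ) 2026-08-28T05:11:36Z: typed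
now, its `_holds` — the Segre-product road below — is the typer's next item):

* `BallFS.fsFormClass_weight_comm` — **the weight law**: for projective systems `G`, `G'` of automorphic forms of
  weights `k, k' > 0` for `Δ` (holomorphic, automorphic for the canonical cocycle `j(δ, z)ᵏ`, nowhere zero), the de Rham
  classes of their Fubini–Study forms on `Δ\𝔹²` satisfy `k' · [[G]^*ω_FS] = k · [[G']^*ω_FS]` in `H²_dR(Δ\𝔹²; ℝ)` —
  i.e. the ray `ℝ_{>0} · (1/k)[[G]^*ω_FS]` (classically `c₁(K^{⊗k})/k = c₁(K)`, `[G]^*𝒪(1) = K^{⊗k}`) does not depend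
  on the system nor on its weight.  PROOF ROAD (not yet in the tree): the Segre product `G ⊗ G'` is a projective system
  of weight `k + k'` with `(G ⊗ G')^*α₀ = G^*α₀ + G'^*α₀` POINTWISE for the Fubini–Study potential
  `α₀(Z) = Im⟪Z, ·⟫/‖Z‖²` of `UnitaryBallAutomorphicFubiniStudyExact` (`⟪G ⊗ G', dG u ⊗ G'⟫ = ⟪G, dG u⟫ ‖G'‖²`), hence
  `[G ⊗ G']^*ω_FS = [G]^*ω_FS + [G']^*ω_FS`; then compare `G^{⊗k'}` and `G'^{⊗k}` (same weight `kk'`) by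
  `deRhamCohomology_mk_fsForm_eq`.

Consumer: the Model-side gluing of the Kähler class system of the Picard modular tower (A-p09 g2; with
`UnitaryBallQuotientKaehlerPullback(System)`: the pull-backs of two pinned Kähler–rational classes to a common level
compare to Fubini–Study classes of twisted systems of DIFFERENT weights, which this law puts on one real ray).

## References

* P. Griffiths, J. Harris, *Principles of Algebraic Geometry* (1978), Ch. 1 §2 («the pull-back of the hyperplane
  bundle under the map of a linear system is the line bundle of the system»; here `[G]^*𝒪(1) = K^{⊗k}`) and Ch. 0 §2
  (Fubini–Study form). [GriffithsHarrisPrinciples1978]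
* I. R. Shafarevich, *Basic Algebraic Geometry 2* (Springer 1994), Ch. IX §3.2 (automorphic forms of weight `k` as
  sections of `K^{⊗k}` on `D/G`; products of forms add weights). [Shafarevich1994]
* C. Voisin, *Hodge Theory and Complex Algebraic Geometry I* (2002), §3.3.2 (Fubini–Study metric and `𝒪(1)`),
  §7.1.2. [VoisinHodgeI2002]

## Provenance

hodgecm-mathlib cell, typer seat B-typ03, row B3-25 (β): the one analytic input of the debt-0 road to the Kähler
class system of the Picard tower (scoping report 2026-08-28T04:49Z).  Statement only; no instance, no notation.
-/

noncomputable section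

open scoped Manifold ContDiff Topology
open Set Function MulAction
open Literature.Geometry.ComplexHyperbolic
open Literature.Geometry.ComplexHyperbolic.BallModel (U21 Ball)
open Literature.Geometry.Manifold
open Literature.Geometry.Kaehler
open Literature.NumberTheory.Automorphic.AutomorphyFactor

namespace Literature.AlgebraicGeometry.ShimuraVarieties

namespace BallFS

open BallForms (canonicalCocycle)

/-- **The weight law of Fubini–Study classes on a free ball quotient.**  For `Δ ≤ U(2,1)` acting freely and
properly discontinuously on `𝔹²` and projective systems `G : 𝔹² → ℂᴺ⁺¹`, `G' : 𝔹² → ℂᴺ'⁺¹` of holomorphic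
automorphic forms of weights `k, k' > 0` (canonical cocycle `j(δ, z)ᵏ`) without common zero, the de Rham classes of
the pulled-back Fubini–Study forms on `Δ\𝔹²` satisfy `k' · [[G]^*ω_FS] = k · [[G']^*ω_FS]` in `H²_dR(Δ\𝔹²; ℝ)`
(`[G]^*𝒪_{ℙᴺ}(1) = K^{⊗k}`, so `[[G]^*ω_FS]` is `k` times the class of the canonical bundle, in the tree's
normalisation of `ω_FS`).  The case `k = k'` is the tree's `BallFS.deRhamCohomology_mk_fsForm_eq`.
[cite: GriffithsHarrisPrinciples1978, Ch. 1 §2 and Ch. 0 §2] [cite: Shafarevich1994, Ch. IX §3.2]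
[cite: VoisinHodgeI2002, §3.3.2] -/
def fsFormClass_weight_comm : Prop :=
  ∀ {Δ : Subgroup U21} [ProperlyDiscontinuousSMul Δ Ball] [IsCancelSMul Δ Ball] {N N' k k' : ℕ}
    {G : Ball → EuclideanSpace ℂ (Fin (N + 1))} {G' : Ball → EuclideanSpace ℂ (Fin (N' + 1))}
    (hGh : MDifferentiable 𝓘(ℂ, Fin 2 → ℂ) 𝓘(ℂ, EuclideanSpace ℂ (Fin (N + 1))) G)
    (hG : G ∈ factorForms Δ (canonicalCocycle (EuclideanSpace ℂ (Fin (N + 1))) k)) (h0 : ∀ z, G z ≠ 0)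
    (hGh' : MDifferentiable 𝓘(ℂ, Fin 2 → ℂ) 𝓘(ℂ, EuclideanSpace ℂ (Fin (N' + 1))) G')
    (hG' : G' ∈ factorForms Δ (canonicalCocycle (EuclideanSpace ℂ (Fin (N' + 1))) k')) (h0' : ∀ z, G' z ≠ 0),
    0 < k → 0 < k' →
      (k' : ℝ) • deRhamCohomology.mk ⟨fsForm G hG h0, fsForm_mem_closedSmoothForms hGh hG h0⟩ =
        (k : ℝ) • deRhamCohomology.mk ⟨fsForm G' hG' h0', fsForm_mem_closedSmoothForms hGh' hG' h0'⟩

end BallFS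

end Literature.AlgebraicGeometry.ShimuraVarieties

end
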